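import Summits.HodgeConjecture.HodgeConjecture.Theses.AnchorTransport
import Summits.HodgeConjecture.HodgeConjecture.Theorems.AnchorTransportVariationalHodgeCurveBase
import Summits.HodgeConjecture.HodgeConjecture.Theorems.AnchorTransportVariationalHodgeCorrespondenceTransport
import Literature.AlgebraicGeometry.Motives.ComplexPointsEhresmann
import Literature.AlgebraicGeometry.Motives.OpenImmersionGraph
import Literature.AlgebraicGeometry.HodgeTheory.GysinFormalismCorrespondences
import Literature.AlgebraicTopology.SingularHomology.CupProduct

/-!
# Crux `VariationalHodge` (stmt-HodgeConjecture-1076) — line `tame-symbol-splitting`: checked skeleton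

Idea card `Cruxes/VariationalHodge/Ideas/tame-symbol-splitting.md` (triage r1: pass ×3): over the
discrete valuation ring of a curve base at the anchor `s₀`, the variational Hodge crux SPLITS through
the intermediate group of TAME CLASSES `T(s₀) = cl ∂ CH^{p+1}(X_η̄, 1) ⊆ H²ᵖ(X₀)`
(`cl sp CH^p(X_η̄) ⊆ T(s₀) ⊆ Alg^p(X₀)`) into
(T1) TAME — every monodromy-invariant algebraic anchor class is a tame class, and
(T2) RIGID — every invariant tame class is a specialisation class.

## How the split is typed on the tree's real carriers (no cycle class map exists in the tree)

The two halves meet in the class `cl(Z₀)` of a tame cycle; the tree has Chow groups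
(`Motives.ChowGroup`, `ratTrivial`) but NO cycle class map into `complexBetti` (`GysinFormalism` /
`BettiCycleData` are parameter structures without instance, and no complex orientation is pinned), so
`T(s₀)` itself cannot be placed between `Alg` and `Sp` today. The line is therefore typed through the
BETTI ENVELOPE of the tame classes,

  `T′(s₀) := { Res_{s₀} σ : σ ∈ H^{2p+1}(𝒳_{U∖s₀}(ℂ); ℂ) supported on a closed algebraic W ⊂ 𝒳_{U∖s₀}`
  `           of fibrewise codimension ≥ p }`   (`U ∋ s₀` an affine neighbourhood),

which needs only restriction maps, supports (`complexBetti.restrictCompl`) and the cup product: since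
`Res_{s₀}(A ∪ f^*θ) = A|_{X₀}` for the logarithmic class `θ` of the puncture and `ker Res_{s₀}` is the
image of `H^{2p+1}(𝒳_U)`, membership `A|_{X₀} ∈ T′(s₀)` is the residue-free condition
`A ∪ f^*θ ∈ (classes supported on W) + im H^{2p+1}(𝒳_U(ℂ))` for all `θ ∈ H¹((U∖s₀)(ℂ))`
(`IsConiveauTame` below). One has `cl sp CH^p(X_η̄) ⊆ T(s₀) ⊆ T′(s₀) ⊆ Alg^p(X₀)` (the regulator
current `Σ δ_{Wᵢ} ∧ dlog fᵢ` of a higher Chow cycle `Γ = Σ (Wᵢ, fᵢ)` is closed, supported on `⋃ Wᵢ`, and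
has residue `cl ∂Γ`; residues preserve algebraic supports). Why `T′(s₀)` is genuinely intermediate
although `X_{s₀}` is a SMOOTH fibre (trivial local monodromy on `𝒳`): by duality
`H^{2p+1}_W(𝒳_{Δ*}) ≅ H^{BM}_{2(n-p)+1}(W_{Δ*})`, and by the Wang sequence of `W_{Δ*} → Δ*` its residues
are (i) the specialisations of monodromy-invariant combinations of components of `W_t` — specialisation
classes — plus (ii) the Picard–Lefschetz VARIATIONS in `X_{s₀}` of invariant odd-degree cycles of `W_t`
(non-zero only where `W̄ → Δ` degenerates at `s₀`; these are the singularities of higher normal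
functions, e.g. del Angel–Müller-Stach / Chen–Doran–Kerr–Lewis for `K₁` of K3 families, whose
residues are the jumping Néron–Severi classes). T2′ says such a variation is a specialisation class as
soon as it extends to a global Hodge class; T1′ says every invariant anchor class is reached. So

* `stub_anchorConiveauTame`  (T1′ ⟸ T1 ⟸ Beilinson–Hodge `BH^{p+1,1}(𝒳_{U∖s₀})`, triage k2): after a
  base change by a smooth affine curve `S₁ → S` surjective on complex points, the anchor class is
  coniveau-tame at a point over `s₀`;
* `stub_coniveauTameRigid`   (T2′ ⟹ T2; T2′ ⟸ VHC on curves; HARDEST): a coniveau-tame anchored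
  global class is a SPECIALISATION FAMILY — after a further surjective curve base change there are a
  closed `W′` of fibrewise codimension `≥ p` over the WHOLE curve and a global class supported on `W′`
  with the anchor's restriction at a point over `s₀` (`IsSpecialisationFamily`);
* `stub_smoothCurveThroughTwoPoints` (vendored fact `Motives.mumford_smoothCurve_through_two_points`,
  Mumford AV §6 + normalisation; tier-0 debt shared with the landed `variationalHodge_of_curveBase`):
  the crux reduces to smooth irreducible affine curve bases — the card's First lemma
  `CurveBaseReduction`, landed modulo exactly this fact (p94736).

Composition (`VariationalHodge_of`, no `sorry` outside the stubs): reduce to a curve base; T1′ gives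
coniveau-tameness over `S₁ ↠ S`; T2′ gives `(C ↠ S₁, W′, G′)` with `G′|_{c₀} = A″|_{c₀}`; two global
classes agreeing on one fibre of a smooth projective family over a smooth irreducible affine base agree
on every fibre (`complexBetti_map_fiberι_eq_of_eq`, landed p93338); `G′|_t` dies off `W′ ∩ X_t`, a
closed subset of codimension `≥ p` of the fibre, hence is an algebraic class
(`mem_supportedClasses_of_restrictCompl_eq_zero`); descend along the two base changes
(`map_fiberι_familyPullback_mem_algebraicClasses_iff`) using surjectivity on complex points.

Disproof used: `Cruxes/VariationalHodge/Disproof.lean` §1–§2 — `hodgeConjecture_imp` (HC ⇒ V: no stub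
here is refutable short of ¬HC; indeed VHC ⇒ T1′ ∧ T2′), `withoutAnchor_iff_hodgeConjecture` (the
anchor carries all content: it enters T1′ as the class to be made tame and T2′ as the anchored residue),
base hypotheses (irreducible: unique generic fibre / connected `C(ℂ)` in the flat-uniqueness step;
smooth: DVR at `s₀`, `Smooth C.hom` in `complexBetti_map_fiberι_eq_of_eq`). Landed Negative lemma
`Theorems/VariationalHodge/Negative/AnchorLoadBearing.lean`: no stub deletes the anchor. Dead line
`Sketch` (costume certificate p96133): avoided — no stub posits transport operators; T2′'s hypothesis
is an `A`-independent support condition in the punctured family, T1′'s conclusion is not the crux's.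
-/

noncomputable section

-- every declaration of this crux lives in `Summit.HodgeConjecture.HodgeConjecture.…` (summit = sub-problem)
set_option linter.dupNamespace false

open CategoryTheory AlgebraicGeometry TopologicalSpace
open Literature.AlgebraicGeometry.Motives Literature.AlgebraicGeometry.HodgeTheory
open Literature.AlgebraicTopology.SingularHomology
open Summit.HodgeConjecture.HodgeConjecture.Theses.AnchorTransport
open Summit.HodgeConjecture.HodgeConjecture.Theorems

namespace Summit.HodgeConjecture.HodgeConjecture.Cruxes.VariationalHodge.TameSymbolSplitting

/-! ## §1 Definitions on real carriers -/

section Defs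

variable {𝒳 S : SchemeOver ℂ}

/-- `W ⊆ 𝒳` has codimension `≥ p` in EVERY fibre of `f` over a complex point: each point of the fibre
`𝒳_t` lying on `W` has codimension (`Order.coheight`, as in `algebraicClasses`) at least `p` in `𝒳_t`.
For `W` closed this says: horizontal components have codimension `≥ p`, vertical ones codimension
`≥ p` in their fibre. -/
def FibrewiseCodimGE (f : 𝒳 ⟶ S) (W : Set 𝒳.left) (p : ℕ) : Prop :=
  ∀ (t : ComplexPoints S) (z : (fiberOver f t).left),
    (fiberι f t).left.base z ∈ W → (p : ℕ∞) ≤ Order.coheight z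

/-- The classes of `Hⁱ(𝒳(ℂ); ℂ)` supported on `W ⊆ 𝒳`: the kernel of the restriction to `(𝒳 ∖ W)(ℂ)`
(the generators of the tree's `supportedClasses`). -/
def supportedOn (𝒳 : SchemeOver ℂ) (W : Set 𝒳.left) (i : ℕ) : Submodule ℂ (complexBetti 𝒳 i) :=
  LinearMap.ker (complexBetti.restrictCompl 𝒳 W i).hom

/-- Inclusion `O ↪ O'` of open subschemes of a `ℂ`-scheme, as a morphism over `ℂ`. -/
def openInclOver (X : SchemeOver ℂ) {O O' : X.left.Opens} (h : O ≤ O') :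
    openSubschemeOver X O ⟶ openSubschemeOver X O' :=
  Over.homMk (X.left.homOfLE h) (by
    change X.left.homOfLE h ≫ O'.ι ≫ X.hom = O.ι ≫ X.hom
    rw [← Category.assoc, Scheme.homOfLE_ι])

/-- **Coniveau-tameness of a global class at `s₀`** (membership of `A|_{X_{s₀}}` in the Betti envelope
`T′(s₀)` of the tame classes, residue-free form). There are an affine open `U ∋ pt s₀` of the base,
its puncture `V = U ∖ {pt s₀}`, and a closed `W ⊆ 𝒳_V := f⁻¹V` of fibrewise codimension `≥ p` such that
for EVERY `θ ∈ H¹(V(ℂ); ℂ)` the class `A|_{𝒳_V} ∪ (f|_V)^* θ ∈ H^{2p+1}(𝒳_V(ℂ); ℂ)` is the sum of a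
class supported on `W` and a class extending to `𝒳_U = f⁻¹U`. (For `θ` extending to `U(ℂ)` this is
automatic; for the logarithmic class of the puncture it says `Res_{s₀}` of a `W`-supported class is
`A|_{X_{s₀}}`. Every tame symbol `Γ` of `K₁` of the geometric generic fibre gives such a class, its
regulator, with `W = |Γ|`.) -/
def IsConiveauTame (f : 𝒳 ⟶ S) (p : ℕ) (A : complexBetti 𝒳 (2 * p)) (s₀ : ComplexPoints S) : Prop :=
  ∃ (U V : S.left.Opens) (hVU : V ≤ U), IsAffineOpen U ∧ s₀.pt ∈ U ∧
    (∀ x : S.left, x ∈ V ↔ x ∈ U ∧ x ≠ s₀.pt) ∧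
    ∃ (W : Set (openSubschemeOver 𝒳 (f.left ⁻¹ᵁ V)).left), IsClosed W ∧
      FibrewiseCodimGE (restrictOverHom f V) W p ∧
      ∀ θ : complexBetti (openSubschemeOver S V) 1,
        cupProduct (show 2 * p + 1 = 2 * p + 1 from rfl)
            (complexBetti.map (openSubschemeOverι 𝒳 (f.left ⁻¹ᵁ V)) (2 * p) A)
            (complexBetti.map (restrictOverHom f V) 1 θ) ∈
          supportedOn (openSubschemeOver 𝒳 (f.left ⁻¹ᵁ V)) W (2 * p + 1) ⊔
            LinearMap.range
              (complexBetti.map (openInclOver 𝒳 (f.left.preimage_mono hVU)) (2 * p + 1)).hom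

/-- **`A` is a specialisation family at `s₀`** (the cohomological form of
`A|_{X_{s₀}} ∈ cl sp CH^p(X_η̄)`): after a base change along a morphism `g : C ⟶ S` from a smooth
irreducible affine CURVE that is surjective on complex points (e.g. the normalisation of `S` in a
finite extension of its function field), there are a point `c₀` over `s₀`, a closed
`W ⊆ 𝒳 ×_S C` of fibrewise codimension `≥ p` over the WHOLE of `C`, and a global class `G` on
`𝒳 ×_S C` supported on `W` whose restriction to the fibre at `c₀` is that of (the pull-back of) `A`.
(Classically: `G = cl(𝒵̄)` for the closure of a codimension-`p` cycle of the generic fibre.) -/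
def IsSpecialisationFamily (f : 𝒳 ⟶ S) (p : ℕ) (A : complexBetti 𝒳 (2 * p))
    (s₀ : ComplexPoints S) : Prop :=
  ∃ (C : SchemeOver ℂ) (g : C ⟶ S), IsAffine C.left ∧ IrreducibleSpace C.left ∧
    AlgebraicGeometry.Smooth C.hom ∧ topologicalKrullDim C.left = 1 ∧
    Function.Surjective (AlgPoints.map (L := ℂ) g) ∧
    ∃ c₀ : ComplexPoints C, AlgPoints.map g c₀ = s₀ ∧
      ∃ W : Set (familyPullback f g).left, IsClosed W ∧
        FibrewiseCodimGE (familyPullback.snd f g) W p ∧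
        ∃ G : complexBetti (familyPullback f g) (2 * p),
          complexBetti.restrictCompl (familyPullback f g) W (2 * p) G = 0 ∧
          complexBetti.map (fiberι (familyPullback.snd f g) c₀) (2 * p) G =
            complexBetti.map (fiberι (familyPullback.snd f g) c₀) (2 * p)
              (complexBetti.map (familyPullback.fst f g) (2 * p) A)

end Defs

/-! ## §2 The statements of the line -/

/-- **T1′ — anchors are coniveau-tame** (the TAME half). For a smooth projective family over a smooth
irreducible affine curve, a global class with rational `(p,p)` fibre restrictions, algebraic on the
fibre at `s₀`: after a base change along a morphism from a smooth irreducible affine curve surjective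
on complex points, the pulled-back class is coniveau-tame at a point over `s₀`. Classically implied by
T1 of the card (`Alg ∩ H^{fin} ⊆ T(s₀)`), hence by Beilinson–Hodge `BH^{p+1,1}` of the punctured family;
a coniveau statement for the Hodge class `A ∪ dlog π` in `H^{2p+1}` of the open total space. -/
def AnchorIsConiveauTame : Prop :=
  ∀ ⦃n : ℕ⦄ ⦃𝒳 S : SchemeOver ℂ⦄ (f : 𝒳 ⟶ S), IsSmoothProjectiveFamily f n →
    IrreducibleSpace S.left → IsAffine S.left → AlgebraicGeometry.Smooth S.hom →
    topologicalKrullDim S.left = 1 →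
    ∀ (p : ℕ) (A : complexBetti 𝒳 (2 * p)),
    (∀ s : ComplexPoints S, IsRationalClass (complexBetti.map (fiberι f s) (2 * p) A) ∧
      IsOfHodgeType n (fiberOver f s) (2 * p) p p (complexBetti.map (fiberι f s) (2 * p) A)) →
    ∀ s₀ : ComplexPoints S,
      complexBetti.map (fiberι f s₀) (2 * p) A ∈ algebraicClasses (fiberOver f s₀) p →
      ∃ (S₁ : SchemeOver ℂ) (g : S₁ ⟶ S), IsAffine S₁.left ∧ IrreducibleSpace S₁.left ∧
        AlgebraicGeometry.Smooth S₁.hom ∧ topologicalKrullDim S₁.left = 1 ∧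
        Function.Surjective (AlgPoints.map (L := ℂ) g) ∧
        ∃ s₁ : ComplexPoints S₁, AlgPoints.map g s₁ = s₀ ∧
          IsConiveauTame (familyPullback.snd f g) p
            (complexBetti.map (familyPullback.fst f g) (2 * p) A) s₁

/-- **T2′ — coniveau-tame anchors are specialisation families** (the RIGID half; hardest). For a smooth
projective family over a smooth irreducible affine curve and a global class with rational `(p,p)` fibre
restrictions, algebraic at `s₀` AND coniveau-tame at `s₀`, the class is a specialisation family at
`s₀`. Classically: `T′(s₀) ∩ H^{fin} ⊆ cl sp CH^p(X_η̄)` — implies the card's T2 and is implied by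
VHC on curves; the card's mechanism (residues of the `W`-supported class on the complete curve,
reciprocity `Σ_x π_inv Res_x = 0`, control at degenerations) applies to it verbatim. -/
def ConiveauTameIsSpecialisation : Prop :=
  ∀ ⦃n : ℕ⦄ ⦃𝒳 S : SchemeOver ℂ⦄ (f : 𝒳 ⟶ S), IsSmoothProjectiveFamily f n →
    IrreducibleSpace S.left → IsAffine S.left → AlgebraicGeometry.Smooth S.hom →
    topologicalKrullDim S.left = 1 →
    ∀ (p : ℕ) (A : complexBetti 𝒳 (2 * p)),
    (∀ s : ComplexPoints S, IsRationalClass (complexBetti.map (fiberι f s) (2 * p) A) ∧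
      IsOfHodgeType n (fiberOver f s) (2 * p) p p (complexBetti.map (fiberι f s) (2 * p) A)) →
    ∀ s₀ : ComplexPoints S,
      complexBetti.map (fiberι f s₀) (2 * p) A ∈ algebraicClasses (fiberOver f s₀) p →
      IsConiveauTame f p A s₀ → IsSpecialisationFamily f p A s₀

/-- The crux restricted to smooth irreducible affine CURVE bases — the hypothesis shape of the landed
reduction `variationalHodge_of_curveBase`. -/
def VariationalHodgeCurveBase : Prop :=
  ∀ ⦃n : ℕ⦄ ⦃𝒳 S : SchemeOver ℂ⦄ (f : 𝒳 ⟶ S), IsSmoothProjectiveFamily f n →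
    IrreducibleSpace S.left → IsAffine S.left → AlgebraicGeometry.Smooth S.hom →
    topologicalKrullDim S.left = 1 →
    ∀ (p : ℕ) (A : complexBetti 𝒳 (2 * p)),
    (∀ s : ComplexPoints S, IsRationalClass (complexBetti.map (fiberι f s) (2 * p) A) ∧
      IsOfHodgeType n (fiberOver f s) (2 * p) p p (complexBetti.map (fiberι f s) (2 * p) A)) →
    (∃ s₀ : ComplexPoints S,
      complexBetti.map (fiberι f s₀) (2 * p) A ∈ algebraicClasses (fiberOver f s₀) p) →
    ∀ s : ComplexPoints S,
      complexBetti.map (fiberι f s) (2 * p) A ∈ algebraicClasses (fiberOver f s) p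

/-! ## §3 Registered stubs (`sorry` lives ONLY in these three theorems) -/

section Stubs

/-- STUB T1′ (registered form = `AnchorIsConiveauTame`): anchors become coniveau-tame after a surjective
curve base change. -/
theorem stub_anchorConiveauTame :
    ∀ ⦃n : ℕ⦄ ⦃𝒳 S : SchemeOver ℂ⦄ (f : 𝒳 ⟶ S), IsSmoothProjectiveFamily f n →
      IrreducibleSpace S.left → IsAffine S.left → AlgebraicGeometry.Smooth S.hom →
      topologicalKrullDim S.left = 1 →
      ∀ (p : ℕ) (A : complexBetti 𝒳 (2 * p)),
      (∀ s : ComplexPoints S, IsRationalClass (complexBetti.map (fiberι f s) (2 * p) A) ∧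
        IsOfHodgeType n (fiberOver f s) (2 * p) p p (complexBetti.map (fiberι f s) (2 * p) A)) →
      ∀ s₀ : ComplexPoints S,
        complexBetti.map (fiberι f s₀) (2 * p) A ∈ algebraicClasses (fiberOver f s₀) p →
        ∃ (S₁ : SchemeOver ℂ) (g : S₁ ⟶ S), IsAffine S₁.left ∧ IrreducibleSpace S₁.left ∧
          AlgebraicGeometry.Smooth S₁.hom ∧ topologicalKrullDim S₁.left = 1 ∧
          Function.Surjective (AlgPoints.map (L := ℂ) g) ∧
          ∃ s₁ : ComplexPoints S₁, AlgPoints.map g s₁ = s₀ ∧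
            IsConiveauTame (familyPullback.snd f g) p
              (complexBetti.map (familyPullback.fst f g) (2 * p) A) s₁ := by
  sorry

/-- STUB T2′ (registered form = `ConiveauTameIsSpecialisation`; HARDEST): coniveau-tame anchored
classes are specialisation families. -/
theorem stub_coniveauTameRigid :
    ∀ ⦃n : ℕ⦄ ⦃𝒳 S : SchemeOver ℂ⦄ (f : 𝒳 ⟶ S), IsSmoothProjectiveFamily f n →
      IrreducibleSpace S.left → IsAffine S.left → AlgebraicGeometry.Smooth S.hom →
      topologicalKrullDim S.left = 1 →
      ∀ (p : ℕ) (A : complexBetti 𝒳 (2 * p)),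
      (∀ s : ComplexPoints S, IsRationalClass (complexBetti.map (fiberι f s) (2 * p) A) ∧
        IsOfHodgeType n (fiberOver f s) (2 * p) p p (complexBetti.map (fiberι f s) (2 * p) A)) →
      ∀ s₀ : ComplexPoints S,
        complexBetti.map (fiberι f s₀) (2 * p) A ∈ algebraicClasses (fiberOver f s₀) p →
        IsConiveauTame f p A s₀ → IsSpecialisationFamily f p A s₀ := by
  sorry

/-- STUB S0 (registered form = the vendored fact `Motives.mumford_smoothCurve_through_two_points`,
Mumford, Abelian Varieties §6 Lemma + normalisation): two distinct complex points of an irreducible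
affine variety lie in the image of a smooth irreducible affine curve. Tier-0 debt of the tree, shared
with the landed `variationalHodge_of_curveBase`; listed as a stub because a skeleton may take no
unproved hypothesis. -/
theorem stub_smoothCurveThroughTwoPoints :
    ∀ ⦃S : SchemeOver ℂ⦄, IsAffine S.left → LocallyOfFiniteType S.hom →
      ∀ (Z : Set S.left), IsClosed Z → IsIrreducible Z →
      ∀ (a b : ComplexPoints S), a.pt ∈ Z → b.pt ∈ Z → a ≠ b →
        ∃ (C : SchemeOver ℂ) (g : C ⟶ S) (a' b' : ComplexPoints C),
          IsAffine C.left ∧ IrreducibleSpace C.left ∧ AlgebraicGeometry.Smooth C.hom ∧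
            topologicalKrullDim C.left = 1 ∧ (∀ c : C.left, g.left.base c ∈ Z) ∧
            AlgPoints.map g a' = a ∧ AlgPoints.map g b' = b := by
  sorry

/-! ### Consistency: each named statement IS its registered stub (definitional unfolding only) -/

theorem anchorIsConiveauTame_holds : AnchorIsConiveauTame := stub_anchorConiveauTame
theorem coniveauTameIsSpecialisation_holds : ConiveauTameIsSpecialisation := stub_coniveauTameRigid
theorem smoothCurveThroughTwoPoints_holds : mumford_smoothCurve_through_two_points :=
  stub_smoothCurveThroughTwoPoints

end Stubs

/-! ### Name-keyed aliases (the skeleton audit matches a hypothesis head to a declared stub by its last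
name component) -/
namespace Registered

/-- Alias of `AnchorIsConiveauTame` keyed by the registered stub name. -/
abbrev stub_anchorConiveauTame : Prop := AnchorIsConiveauTame
/-- Alias of `ConiveauTameIsSpecialisation` keyed by the registered stub name. -/
abbrev stub_coniveauTameRigid : Prop := ConiveauTameIsSpecialisation
/-- Alias of the vendored fact keyed by the registered stub name. -/
abbrev stub_smoothCurveThroughTwoPoints : Prop := mumford_smoothCurve_through_two_points

end Registered

/-! ## §4 Glue (no `sorry` below this line) -/

section Glue

/-- **A global class supported on a closed subset of fibrewise codimension `≥ p` is algebraic on every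
fibre**: its restriction to `𝒳_t` dies off `W ∩ 𝒳_t` (`complexBetti.restrictCompl_map_eq_zero`), a
closed subset of the fibre all of whose points have codimension `≥ p`, so it lies among the generators
of `algebraicClasses 𝒳_t p` (`mem_supportedClasses_of_restrictCompl_eq_zero`). -/
theorem map_fiberι_mem_algebraicClasses_of_supported {𝒳 S : SchemeOver ℂ} (f : 𝒳 ⟶ S) {p : ℕ}
    {W : Set 𝒳.left} (hW : IsClosed W) (hWcod : FibrewiseCodimGE f W p)
    {G : complexBetti 𝒳 (2 * p)} (hG : complexBetti.restrictCompl 𝒳 W (2 * p) G = 0)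
    (t : ComplexPoints S) :
    complexBetti.map (fiberι f t) (2 * p) G ∈ algebraicClasses (fiberOver f t) p :=
  mem_supportedClasses_of_restrictCompl_eq_zero (Z := (fiberι f t).left.base ⁻¹' W)
    (hW.preimage (fiberι f t).left.continuous) (fun z hz => hWcod t z hz)
    (complexBetti.restrictCompl_map_eq_zero (fiberι f t) hG)

/-- **A specialisation family is algebraic on every fibre.** On the smooth irreducible affine curve `C`
the supported class `G` and the pull-back of `A` agree on the fibre at `c₀`, hence on every fibre
(`complexBetti_map_fiberι_eq_of_eq`); `G` is algebraic on every fibre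
(`map_fiberι_mem_algebraicClasses_of_supported`); descend along the base change
(`map_fiberι_familyPullback_mem_algebraicClasses_iff`) using surjectivity on complex points. -/
theorem forall_mem_algebraicClasses_of_isSpecialisationFamily {n p : ℕ} {𝒳 S : SchemeOver ℂ}
    (f : 𝒳 ⟶ S) (hf : IsSmoothProjectiveFamily f n) (A : complexBetti 𝒳 (2 * p))
    (s₀ : ComplexPoints S) (h : IsSpecialisationFamily f p A s₀) (s : ComplexPoints S) :
    complexBetti.map (fiberι f s) (2 * p) A ∈ algebraicClasses (fiberOver f s) p := by
  obtain ⟨C, g, hCaff, hCirr, hCsm, -, hsurj, c₀, -, W, hW, hWcod, G, hGsupp, hGc₀⟩ := h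
  obtain ⟨t, rfl⟩ := hsurj s
  haveI := hCaff
  haveI := hCirr
  haveI := hCsm
  haveI : IsAffineHom C.hom := inferInstance
  haveI : IsSeparated C.hom := inferInstance
  haveI : CompactSpace C.left := isCompact_univ_iff.mp (isAffineOpen_top C.left).isCompact
  have hf' : IsSmoothProjectiveFamily (familyPullback.snd f g) n := hf.familyPullback_snd g
  -- `G` and the pull-back of `A` agree at `c₀`, hence at `t`
  have hGt := complexBetti_map_fiberι_eq_of_eq (familyPullback.snd f g) hf' (2 * p) G
    (complexBetti.map (familyPullback.fst f g) (2 * p) A) c₀ t hGc₀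
  -- `G|_t` is algebraic, hence so is the pull-back of `A` at `t`, hence `A` at `g t`
  have hGalg := map_fiberι_mem_algebraicClasses_of_supported (familyPullback.snd f g) hW hWcod hGsupp t
  rw [hGt] at hGalg
  exact (map_fiberι_familyPullback_mem_algebraicClasses_iff f g hf A t).1 hGalg

/-- **T1′ ∧ T2′ ⇒ the crux over curve bases.** Base-change along the curve `S₁ ↠ S` given by T1′
(hypotheses and anchor move by `familyPullback_fibrewise_rational_hodgeType`,
`map_fiberι_familyPullback_mem_algebraicClasses_iff`), apply T2′ at the tame point `s₁`, conclude on
every fibre of the base change (`forall_mem_algebraicClasses_of_isSpecialisationFamily`) and descend to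
`S` by surjectivity on complex points. -/
theorem variationalHodgeCurveBase_of (h₁ : Registered.stub_anchorConiveauTame)
    (h₂ : Registered.stub_coniveauTameRigid) : VariationalHodgeCurveBase := by
  intro n 𝒳 S f hf hirr haff hsm hdim p A hA hs₀ s
  obtain ⟨s₀, hs₀⟩ := hs₀
  obtain ⟨S₁, g, h1aff, h1irr, h1sm, h1dim, hsurj, s₁, hs₁, htame⟩ :=
    h₁ f hf hirr haff hsm hdim p A hA s₀ hs₀
  have hf₁ : IsSmoothProjectiveFamily (familyPullback.snd f g) n := hf.familyPullback_snd g
  have hA₁ := familyPullback_fibrewise_rational_hodgeType f g A hA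
  have hs₁alg : complexBetti.map (fiberι (familyPullback.snd f g) s₁) (2 * p)
      (complexBetti.map (familyPullback.fst f g) (2 * p) A) ∈
        algebraicClasses (fiberOver (familyPullback.snd f g) s₁) p := by
    rw [map_fiberι_familyPullback_mem_algebraicClasses_iff f g hf A s₁, hs₁]
    exact hs₀
  have hsp := h₂ (familyPullback.snd f g) hf₁ h1irr h1aff h1sm h1dim p
    (complexBetti.map (familyPullback.fst f g) (2 * p) A) hA₁ s₁ hs₁alg htame
  obtain ⟨t₁, rfl⟩ := hsurj s
  exact (map_fiberι_familyPullback_mem_algebraicClasses_iff f g hf A t₁).1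
    (forall_mem_algebraicClasses_of_isSpecialisationFamily (familyPullback.snd f g) hf₁ _ s₁ hsp t₁)

end Glue

/-! ## §5 Composition: the crux BY NAME from the three registered stubs -/

/-- **The crux `AnchorTransport.VariationalHodge` from the stubs**, as glue with admissible hypotheses
(each keyed to a registered stub): reduce to smooth irreducible affine curve bases
(`variationalHodge_of_curveBase`, which consumes the Mumford fact S0) and apply
`variationalHodgeCurveBase_of` (T1′, T2′). -/
theorem VariationalHodge_of (h₀ : Registered.stub_smoothCurveThroughTwoPoints)
    (h₁ : Registered.stub_anchorConiveauTame) (h₂ : Registered.stub_coniveauTameRigid) :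
    VariationalHodge :=
  variationalHodge_of_curveBase h₀ (variationalHodgeCurveBase_of h₁ h₂)

/-- Wiring check: the registered stubs feed the composition as stated (definitional unfolding only). -/
theorem variationalHodge_holds_of_stubs : VariationalHodge :=
  VariationalHodge_of stub_smoothCurveThroughTwoPoints stub_anchorConiveauTame stub_coniveauTameRigid

/-! ## §6 Sanity of the plumbing (proved): the zero class is coniveau-tame at every point

This instantiates every existential of `IsConiveauTame` (`U = ⊤`, `V = ⊤ ∖ {pt s₀}`, `W = ∅`), so the
notion is not vacuous for typing reasons. The CONTENTFUL consistency check — specialisation families are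
coniveau-tame, `Sp ⊆ T′` (the cohomological shadow of `sp = ∂(− ⊗ {π})`) — is the statement
`SpecialisationIsConiveauTame` below, left to the lead as the first thing to prove. -/

/-- The zero class is coniveau-tame (with `W = ∅`). -/
theorem isConiveauTame_zero {𝒳 S : SchemeOver ℂ} [IsAffine S.left] (f : 𝒳 ⟶ S) (p : ℕ)
    (s₀ : ComplexPoints S) : IsConiveauTame f p (0 : complexBetti 𝒳 (2 * p)) s₀ := by
  refine ⟨⊤, ⟨{s₀.pt}ᶜ, (OpenGraph.isClosed_singleton_pt s₀).isOpen_compl⟩, le_top,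
    isAffineOpen_top S.left, trivial, fun x => ?_, ∅, isClosed_empty, fun t z hz => False.elim hz,
    fun θ => ?_⟩
  · simp
  · rw [map_zero, map_zero, LinearMap.zero_apply]
    exact Submodule.zero_mem _

/-- CONSISTENCY STATEMENT (not a stub; `Sp ⊆ T′`): a specialisation family over the curve `S` itself —
a closed `W ⊆ 𝒳` of fibrewise codimension `≥ p` and a global class supported on `W` restricting to
`A|_{X_{s₀}}` at `s₀` — is coniveau-tame at `s₀`. On paper: `(G ∪ f^*θ)|_{𝒳_V}` is supported on
`W ∩ 𝒳_V`, and `(A - G) ∪ f^*θ` has residue `0` at `s₀`, hence extends over `X_{s₀}` (Gysin sequence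
of the smooth divisor `X_{s₀} ⊂ 𝒳_U`). -/
def SpecialisationIsConiveauTame : Prop :=
  ∀ ⦃n : ℕ⦄ ⦃𝒳 S : SchemeOver ℂ⦄ (f : 𝒳 ⟶ S), IsSmoothProjectiveFamily f n →
    IrreducibleSpace S.left → IsAffine S.left → AlgebraicGeometry.Smooth S.hom →
    topologicalKrullDim S.left = 1 →
    ∀ (p : ℕ) (A : complexBetti 𝒳 (2 * p)) (s₀ : ComplexPoints S) (W : Set 𝒳.left),
      IsClosed W → FibrewiseCodimGE f W p →
      ∀ G : complexBetti 𝒳 (2 * p), complexBetti.restrictCompl 𝒳 W (2 * p) G = 0 →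
        complexBetti.map (fiberι f s₀) (2 * p) G = complexBetti.map (fiberι f s₀) (2 * p) A →
        IsConiveauTame f p A s₀

end Summit.HodgeConjecture.HodgeConjecture.Cruxes.VariationalHodge.TameSymbolSplitting

end
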